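import Summits.Ventures.YMGap.RobustBall.StarKernelSusceptibility
import Summits.Ventures.YMGap.RobustBall.StarBoundaryDecayZdGeometric
import Summits.Ventures.YMGap.RobustBall.OneStateBoundary
import Summits.Ventures.YMGap.RobustBall.BoundaryDecayTorus
import Summits.Ventures.YMGap.Thresholds.ImprovedThresholdStar
import Summits.Ventures.YMGap.Thresholds.CouplingDerivativeTools
import HarnessLib

/-!
# Venture YMGap, track DS (seat ds-3) — «C-KMIX-STAR», step 5 (rate form): the finite-volume plaquette susceptibility on a centred
# box with ANY boundary field converges to the infinite-volume susceptibility EXPONENTIALLY FAST in the box size;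
# `SU(2)`, `d = 4`, Wilson, every `0 ≤ β_W ≤ 9/25`

HONEST FRAMING. WHAT THIS IS: a venture file (cell `pub-ymgap`, track DS, seat ds-3; theorems only, no `def`, no named fact),
the quantitative companion of `StarKernelSusceptibilityLimit.lean` and the star-window twin of the seat's `KernelSusceptibilityRate.lean`
(`β_W ≤ 1/12`). For `SU(2)` lattice Yang–Mills on `ℤ⁴` at every `0 ≤ β_W ≤ 9/25` (tree coupling `β_W/2`; unique DLR state `μ`), every
box `M > P`, EVERY boundary field `η` and every plaquette `p` based in `box 4 P`, with `L = ⌊(M − P)/2⌋`, `t = −log max(R_G(β_W), ½)`,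
`s = e^{−t/32}`:

  `|Σ_{q based in box M} cov_{γ_{box M}(·|η)}(W_p, W_q) − Σ_q cov_μ(W_p, W_q)|`
  `   ≤ 6 (2(P+L)+1)⁴ · 1536√2 · R_G(β_W)^{⌊(M − P − L)/4⌋} + 2 · 262144 e^{t(P/2+3/2)} · s^L · 6 ((1+s)/(1−s))⁴`

(`su2_wilson_kernel_susceptibility_star_rate`) — both pieces decay exponentially in `M − P`, uniformly in `η`. MECHANISM: plaquettes `q`
based in `box 4 (P+L)` are handled by the geometric boundary-insensitivity theorem `StarBoundaryDecayZdGeometric.su2_wilson_box_star_geometric`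
(applied to `W_p`, `W_q` and the Lipschitz cylinder `W_pW_q`, all on links based in `box 4 (P+L+1)`), the others (and the tail of the
infinite-volume row outside the box) by the uniform box majorant `StarKernelSusceptibility.abs_cov_plaquette_kernel_box_le_of_starWindowBoundZd`
(the same bound passes to `μ` along the boxes by `boundaryLimit_of_massGapAt`) and rb-p1's `ℓ¹` lattice sums, via `r^{‖v‖₁} = s^{‖v‖₁} s^{‖v‖₁} ≤ s^L s^{‖v‖₁}`.
WHAT THIS IS NOT: the rate is far from optimal and astronomically weak near the frontier; interior form (`p` deep inside the box); lattice
strong coupling; nothing about the continuum limit or the Clay problem.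

References: B. Simon, *The Statistical Mechanics of Lattice Gases* I (1993), §III.2; R. L. Dobrushin, S. B. Shlosman (1985), (1987);
the seat's `StarKernelSusceptibility.lean`, `StarBoundaryDecayZdGeometric.lean`, `OneStateBoundary.lean`, `KernelSusceptibilityRate.lean`.
-/

noncomputable section

open MeasureTheory Filter Function ProbabilityTheory Real Topology
open scoped NNReal
open Literature.Probability.LatticeModels
open Literature.MathematicalPhysics.QuantumLattice
open Literature.MathematicalPhysics.QuantumFieldTheory hiding ZdEdge Site
open Summit.Ventures.YMGap.DSWindowZd
open Summit.Ventures.YMGap.StarWindowGauge (gaugeR gaugeR_lt_one_of_le)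
open Summit.Ventures.YMGap.StarLemmaG (starWindowBound_lemmaG gaugeR_nonneg)
open Summit.Ventures.YMGap.CouplingResponse (isLipschitzCylinder_mul)

namespace Summit.Ventures.YMGap.RobustBall

/-- The links of a plaquette based in `box 4 Q` are based in `box 4 (Q + 1)`. [folklore] -/
theorem plaquetteEdges_subset_box_succ {p : ZdPlaquette 4} {Q : ℕ} (hp : p.1 ∈ box 4 Q) :
    plaquetteEdges p ⊆ (box 4 (Q + 1)) ×ˢ (Finset.univ : Finset (Fin 4)) := by
  intro e he
  refine Finset.mem_product.2 ⟨mem_box.2 fun i => ?_, Finset.mem_univ _⟩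
  have h1' : supNormZd e.1 ≤ Q + 1 := by exact_mod_cast supNormZd_le_of_mem_plaquetteEdges_of_mem_box hp he
  have h3 := natAbs_le_supNormZd e.1 i
  omega

/-- ★★ **THE FINITE-VOLUME SUSCEPTIBILITY WITH ANY BOUNDARY FIELD CONVERGES EXPONENTIALLY FAST IN THE BOX SIZE** (`SU(2)`, `ℤ⁴`, Wilson,
EVERY `0 ≤ β_W ≤ 9/25`, tree coupling `β_W/2`): the DLR states form a singleton `{μ}` and for every `M > P`, EVERY boundary field `η`
and every plaquette `p` based in `box 4 P`, with `L = (M − P)/2` (integer part), `t = −log max(R_G(β_W), ½)`, `s = e^{−t/32}`: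
`|Σ_{q based in box M} cov_{γ_{box M}(·|η)}(W_p, W_q) − Σ_q cov_μ(W_p, W_q)| ≤ 6(2(P+L)+1)⁴ · 1536√2 · R_G(β_W)^{⌊(M+1−(P+L+1))/4⌋}`
`+ 2 · (262144 e^{t(P/2+3/2)}) · s^L · 6((1+s)/(1−s))⁴`, the infinite-volume row being absolutely summable. [folklore] -/
theorem su2_wilson_kernel_susceptibility_star_rate {βW : ℝ} (h0 : 0 ≤ βW) (h : βW ≤ 9 / 25) :
    ∃ μ : Measure (LGConfig 4 (SUN 2)),
      ymGibbsMeasures (d := 4) (fundamentalRep (Fin 2)) (βW / 2) = {μ} ∧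
      ∀ (M P : ℕ), P < M → ∀ (η : LGConfig 4 (SUN 2)) (p : ZdPlaquette 4), p.1 ∈ box 4 P →
        (Summable fun q : ZdPlaquette 4 =>
            cov[zdPlaquetteObs (fundamentalRep (Fin 2)) p.1 p.2.1.1 p.2.1.2,
              zdPlaquetteObs (fundamentalRep (Fin 2)) q.1 q.2.1.1 q.2.1.2; μ]) ∧
        |(∑ q ∈ (box 4 M) ×ˢ (Finset.univ : Finset {o : Fin 4 × Fin 4 // o.1 < o.2}),
            cov[zdPlaquetteObs (fundamentalRep (Fin 2)) p.1 p.2.1.1 p.2.1.2,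
              zdPlaquetteObs (fundamentalRep (Fin 2)) q.1 q.2.1.1 q.2.1.2;
              ymSpecification (d := 4) (fundamentalRep (Fin 2)) (βW / 2)
                ((box 4 M) ×ˢ (Finset.univ : Finset (Fin 4))) η]) -
            ∑' q : ZdPlaquette 4, cov[zdPlaquetteObs (fundamentalRep (Fin 2)) p.1 p.2.1.1 p.2.1.2,
              zdPlaquetteObs (fundamentalRep (Fin 2)) q.1 q.2.1.1 q.2.1.2; μ]| ≤
          6 * (2 * ((P + (M - P) / 2 : ℕ) : ℝ) + 1) ^ 4 * (1536 * Real.sqrt 2) *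
              gaugeR βW ^ ⌊((M : ℝ) + 1 - ((P + (M - P) / 2 + 1 : ℕ) : ℝ)) / (4 : ℕ)⌋₊ +
            2 * (262144 * Real.exp (-Real.log (max (gaugeR βW) (1 / 2)) * (P / 2 + 3 / 2))) *
              Real.exp (-(-Real.log (max (gaugeR βW) (1 / 2)) / 32)) ^ ((M - P) / 2) *
              (6 * ((1 + Real.exp (-(-Real.log (max (gaugeR βW) (1 / 2)) / 32))) /
                (1 - Real.exp (-(-Real.log (max (gaugeR βW) (1 / 2)) / 32)))) ^ 4) := by
  classical
  -- the unique state and the boundary-limit theorem along the centred boxes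
  have hβ : |βW / 4| ≤ 9 / 100 := by rw [abs_of_nonneg (by linarith)]; linarith
  obtain ⟨μ, hG, hlim⟩ := boundaryLimit_of_massGapAt (d := 4) (ImprovedThresholdStar.su2_massGapAt_of_abs_le hβ)
  have e2 : (((2 : ℕ) : ℝ) * (βW / 4) : ℝ) = βW / 2 := by push_cast; ring
  rw [e2] at hG hlim
  have hμ : μ ∈ ymGibbsMeasures (d := 4) (fundamentalRep (Fin 2)) (βW / 2) := by rw [hG]; exact Set.mem_singleton μ
  have hμG : IsGibbsMeasure (ymSpecification (d := 4) (fundamentalRep (Fin 2)) (βW / 2)) μ := hμ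
  haveI := hμG.isProbabilityMeasure
  refine ⟨μ, hG, fun M P hPM η p hp => ?_⟩
  set Λs : ℕ → Finset (ZdEdge 4) := fun n => (box 4 n) ×ˢ (Finset.univ : Finset (Fin 4)) with hΛs
  have hcof : ∀ Δ : Finset (ZdEdge 4), ∀ᶠ n in atTop, Δ ⊆ Λs n := by
    intro Δ
    refine eventually_atTop.2 ⟨Δ.sup fun e => supNormZd e.1, fun n hn e he => ?_⟩
    refine Finset.mem_product.2 ⟨mem_box.2 fun i => ?_, Finset.mem_univ _⟩
    have h1 : supNormZd e.1 ≤ n := (Finset.le_sup (f := fun e : ZdEdge 4 => supNormZd e.1) he).trans hn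
    have h3 := natAbs_le_supNormZd e.1 i
    omega
  obtain ⟨hF, -⟩ := hlim Λs hcof
  set γ := ymSpecification (d := 4) (fundamentalRep (Fin 2)) (βW / 2) with hγdef
  haveI hγprob : ∀ Λ ζ, IsProbabilityMeasure (γ Λ ζ) := fun Λ ζ =>
    isProbabilityMeasure_ymSpecification _ (continuous_fundamentalRep (Fin 2)) _ Λ ζ
  set W : ZdPlaquette 4 → LGConfig 4 (SUN 2) → ℝ :=
    fun r => zdPlaquetteObs (fundamentalRep (Fin 2)) r.1 r.2.1.1 r.2.1.2 with hW
  -- plaquette observables: Lipschitz cylinders (constant 32 on their four links), continuous, bounded by one, in `L²`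
  have hWlip : ∀ r : ZdPlaquette 4, IsLipschitzCylinder (fundamentalRep (Fin 2)) (W r) (plaquetteEdges r) (4 * (2 : ℝ≥0) ^ 3) :=
    fun r => isLipschitzCylinder_zdPlaquetteObs (N := 2) r.1 r.2.2
  have hWc : ∀ r : ZdPlaquette 4, Continuous (W r) := fun r => continuous_of_isLipschitzCylinder (hWlip r)
  have hWb : ∀ r : ZdPlaquette 4, ∀ U, |W r U| ≤ 1 := fun r U =>
    abs_zdPlaquetteObs_le fundamentalRep_mem_unitaryGroup r.1 r.2.1.1 r.2.1.2 U
  have hWb' : ∀ r : ZdPlaquette 4, ∀ U, |W r U| ≤ ((1 : ℝ≥0) : ℝ) := fun r U => by rw [NNReal.coe_one]; exact hWb r U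
  have hWmem : ∀ (r : ZdPlaquette 4) (ν : Measure (LGConfig 4 (SUN 2))) [IsProbabilityMeasure ν], MemLp (W r) 2 ν :=
    fun r ν _ => memLp_of_bounded (a := -1) (b := 1)
      (ae_of_all _ fun U => by simp only [Set.mem_Icc]; exact abs_le.1 (hWb r U)) (hWc r).measurable.aestronglyMeasurable 2
  have hWint : ∀ (r : ZdPlaquette 4) (ν : Measure (LGConfig 4 (SUN 2))) [IsProbabilityMeasure ν], |∫ U, W r U ∂ν| ≤ 1 :=
    fun r ν _ => by
      have := norm_integral_le_of_norm_le_const (μ := ν) (f := W r) (C := 1)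
        (ae_of_all _ fun U => by rw [Real.norm_eq_abs]; exact hWb r U)
      simpa [Real.norm_eq_abs, probReal_univ] using this
  have hcov : ∀ (q : ZdPlaquette 4) (ν : Measure (LGConfig 4 (SUN 2))) [IsProbabilityMeasure ν],
      cov[W p, W q; ν] = (∫ U, W p U * W q U ∂ν) - (∫ U, W p U ∂ν) * ∫ U, W q U ∂ν :=
    fun q ν _ => covariance_eq_sub (hWmem p _) (hWmem q _)
  -- termwise convergence along the boxes with the boundary fields frozen to `η`
  have hterm : ∀ q : ZdPlaquette 4, Tendsto (fun n => cov[W p, W q; γ (Λs n) η]) atTop (𝓝 (cov[W p, W q; μ])) := by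
    intro q
    have h1 := hF (fun _ => η) (fun U => W p U * W q U) ((hWc p).mul (hWc q))
      ⟨1, fun U => by rw [abs_mul]; exact mul_le_one₀ (hWb p U) (abs_nonneg _) (hWb q U)⟩
    have h2 := hF (fun _ => η) (W p) (hWc p) ⟨1, hWb p⟩
    have h3 := hF (fun _ => η) (W q) (hWc q) ⟨1, hWb q⟩
    have hcovn : ∀ n, cov[W p, W q; γ (Λs n) η] =
        (∫ U, W p U * W q U ∂(γ (Λs n) η)) - (∫ U, W p U ∂(γ (Λs n) η)) * ∫ U, W q U ∂(γ (Λs n) η) :=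
      fun n => hcov q _
    rw [show (fun n => cov[W p, W q; γ (Λs n) η]) = fun n =>
        (∫ U, W p U * W q U ∂(γ (Λs n) η)) - (∫ U, W p U ∂(γ (Λs n) η)) * ∫ U, W q U ∂(γ (Λs n) η) from funext hcovn,
      hcov q μ]
    exact h1.sub (h2.mul h3)
  -- the uniform box majorant (star kernel door, saturation absorbed) and its limit for `μ`
  have hρ0 : 0 ≤ gaugeR βW := gaugeR_nonneg h0 (by linarith)
  have hρ1 : gaugeR βW < 1 := gaugeR_lt_one_of_le h0 h
  have hZd : StarWindowBoundZd 4 2 (βW / 2) (gaugeR βW) suFrobDist :=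
    starWindowBoundZd_of_starWindowBound (L := 5) le_rfl suFrobDist_nonneg (starWindowBound_lemmaG (by norm_num) h0 (by linarith))
  set t : ℝ := -Real.log (max (gaugeR βW) (1 / 2)) with ht
  have ht0 : 0 < t := by
    rw [ht, neg_pos]
    exact Real.log_neg (lt_max_of_lt_right (by norm_num)) (max_lt hρ1 (by norm_num))
  set C : ℝ := 262144 * Real.exp (t * (P / 2 + 3 / 2)) with hC
  have hC0 : 0 ≤ C := by positivity
  set s : ℝ := Real.exp (-(t / 32)) with hs
  have hs0 : 0 ≤ s := (Real.exp_pos _).le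
  have hs1 : s < 1 := Real.exp_lt_one_iff.2 (by rw [neg_neg_iff_pos]; positivity)
  set r : ℝ := Real.exp (-(t / 4 / (4 : ℕ))) with hr
  have hr0 : 0 ≤ r := (Real.exp_pos _).le
  have hr1 : r < 1 := Real.exp_lt_one_iff.2 (neg_neg_of_pos (by positivity))
  have hrs : r = s * s := by rw [hr, hs, ← Real.exp_add]; congr 1; push_cast; ring
  have hbound : ∀ (n : ℕ), P < n → ∀ q : ZdPlaquette 4, q.1 ∈ box 4 n →
      |cov[W p, W q; γ (Λs n) η]| ≤ C * r ^ l1 (p.1 - q.1) := by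
    intro n hn q hq
    have hk := abs_cov_plaquette_kernel_box_le_of_starWindowBoundZd (d := 4) (N := 2) hρ0 hρ1 hZd hn η hp hq
    refine hk.trans ?_
    rw [← ht]
    have h262144 : (2048 : ℝ) * ((2 : ℕ) : ℝ) ^ 7 = 262144 := by norm_num
    rw [h262144, ← hC]
    refine mul_le_mul_of_nonneg_left ?_ hC0
    have := exp_neg_norm_le_pow (d := 4) (by norm_num) (m := t / 4) (by positivity) (p.1 - q.1)
    rw [hr]
    convert this using 2
  have hboundμ : ∀ q : ZdPlaquette 4, |cov[W p, W q; μ]| ≤ C * r ^ l1 (p.1 - q.1) := by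
    intro q
    refine le_of_tendsto ((hterm q).abs) ?_
    refine eventually_atTop.2 ⟨max (P + 1) (supNormZd q.1), fun n hn => hbound n ?_ q ?_⟩
    · exact lt_of_lt_of_le (Nat.lt_succ_self P) ((le_max_left _ _).trans hn)
    · refine mem_box.2 fun i => ?_
      have h1 : supNormZd q.1 ≤ n := (le_max_right _ _).trans hn
      have h3 := natAbs_le_supNormZd q.1 i
      omega
  have hsumμ : Summable fun q : ZdPlaquette 4 => cov[W p, W q; μ] :=
    Summable.of_norm_bounded (summable_and_tsum_row_le (d := 4) hC0 hr0 hr1 p).1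
      fun q => by rw [Real.norm_eq_abs]; exact hboundμ q
  refine ⟨hsumμ, ?_⟩
  -- the truncated kernel row `f q = 𝟙[q based in box M] cov_M` and its `tsum`
  set S : ℕ → Finset (ZdPlaquette 4) := fun n => (box 4 n) ×ˢ (Finset.univ : Finset {o : Fin 4 × Fin 4 // o.1 < o.2}) with hS
  set f : ZdPlaquette 4 → ℝ := fun q => if q ∈ S M then cov[W p, W q; γ (Λs M) η] else 0 with hf
  have hfS : ∑' q, f q = ∑ q ∈ S M, cov[W p, W q; γ (Λs M) η] := by
    rw [tsum_eq_sum (s := S M) (fun q hq => if_neg hq)]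
    exact Finset.sum_congr rfl fun q hq => if_pos hq
  have hfb : ∀ q, |f q| ≤ C * r ^ l1 (p.1 - q.1) := by
    intro q
    simp only [hf]
    split_ifs with hq
    · exact hbound M hPM q (Finset.mem_product.1 hq).1
    · rw [abs_zero]; positivity
  have hsumf : Summable f :=
    Summable.of_norm_bounded (summable_and_tsum_row_le (d := 4) hC0 hr0 hr1 p).1
      fun q => by rw [Real.norm_eq_abs]; exact hfb q
  -- the split: `near` = based in `box 4 (P + L)`, handled by boundary insensitivity; the rest by the majorants
  set L : ℕ := (M - P) / 2 with hL
  have hLM : P + L + 1 ≤ M := by omega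
  set Bn : ℝ := 1536 * Real.sqrt 2 * gaugeR βW ^ ⌊((M : ℝ) + 1 - ((P + L + 1 : ℕ) : ℝ)) / (4 : ℕ)⌋₊ with hBn
  have hBn0 : 0 ≤ Bn := by positivity
  have hnear : ∀ q : ZdPlaquette 4, q ∈ S (P + L) → |f q - cov[W p, W q; μ]| ≤ Bn := by
    intro q hq
    have hq' : q.1 ∈ box 4 (P + L) := (Finset.mem_product.1 hq).1
    have hqM : q ∈ S M := by
      refine Finset.mem_product.2 ⟨mem_box.2 fun i => ?_, Finset.mem_univ _⟩
      have := (mem_box.1 hq') i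
      omega
    have hfq : f q = cov[W p, W q; γ (Λs M) η] := if_pos hqM
    rw [hfq]
    -- supports inside `box 4 (P + L + 1)`
    have hp' : p.1 ∈ box 4 (P + L) := by
      refine mem_box.2 fun i => ?_
      have := (mem_box.1 hp) i
      omega
    have hΔp := plaquetteEdges_subset_box_succ hp'
    have hΔq := plaquetteEdges_subset_box_succ hq'
    have hΔpq : plaquetteEdges p ∪ plaquetteEdges q ⊆ (box 4 (P + L + 1)) ×ˢ (Finset.univ : Finset (Fin 4)) :=
      Finset.union_subset hΔp hΔq
    have hprod : IsLipschitzCylinder (fundamentalRep (Fin 2)) (fun U => W p U * W q U)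
        (plaquetteEdges p ∪ plaquetteEdges q) (1 * (4 * (2 : ℝ≥0) ^ 3) + 1 * (4 * (2 : ℝ≥0) ^ 3)) :=
      isLipschitzCylinder_mul (hWlip p) (hWlip q) (hWb' p) (hWb' q)
    have hcardU : ((plaquetteEdges p ∪ plaquetteEdges q).card : ℝ) ≤ 8 := by
      have := (Finset.card_union_le _ _).trans (add_le_add (card_plaquetteEdges_le p) (card_plaquetteEdges_le q))
      exact_mod_cast this
    have hcardp : ((plaquetteEdges p).card : ℝ) ≤ 4 := by exact_mod_cast card_plaquetteEdges_le p
    have hcardq : ((plaquetteEdges q).card : ℝ) ≤ 4 := by exact_mod_cast card_plaquetteEdges_le q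
    have hK : (((1 * (4 * (2 : ℝ≥0) ^ 3) + 1 * (4 * (2 : ℝ≥0) ^ 3) : ℝ≥0)) : ℝ) = 64 := by norm_num
    have hK' : (((4 * (2 : ℝ≥0) ^ 3 : ℝ≥0)) : ℝ) = 32 := by norm_num
    set ρk : ℝ := gaugeR βW ^ ⌊((M : ℝ) + 1 - ((P + L + 1 : ℕ) : ℝ)) / (4 : ℕ)⌋₊ with hρk
    have hρk0 : 0 ≤ ρk := pow_nonneg hρ0 _
    have ha : |(∫ U, W p U * W q U ∂(γ (Λs M) η)) - ∫ U, W p U * W q U ∂μ| ≤ 2 * Real.sqrt 2 * 64 * 8 * ρk := by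
      have h0 := su2_wilson_box_star_geometric h0 h hLM hμ η hprod hΔpq
      rw [hK] at h0
      refine h0.trans ?_
      rw [hρk]
      gcongr
    have hb : |(∫ U, W p U ∂(γ (Λs M) η)) - ∫ U, W p U ∂μ| ≤ 2 * Real.sqrt 2 * 32 * 4 * ρk := by
      have h0 := su2_wilson_box_star_geometric h0 h hLM hμ η (hWlip p) hΔp
      rw [hK'] at h0
      refine h0.trans ?_
      rw [hρk]
      gcongr
    have hc' : |(∫ U, W q U ∂(γ (Λs M) η)) - ∫ U, W q U ∂μ| ≤ 2 * Real.sqrt 2 * 32 * 4 * ρk := by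
      have h0 := su2_wilson_box_star_geometric h0 h hLM hμ η (hWlip q) hΔq
      rw [hK'] at h0
      refine h0.trans ?_
      rw [hρk]
      gcongr
    rw [hcov q (γ (Λs M) η), hcov q μ]
    set a := ∫ U, W p U * W q U ∂(γ (Λs M) η)
    set a' := ∫ U, W p U * W q U ∂μ
    set b := ∫ U, W p U ∂(γ (Λs M) η)
    set b' := ∫ U, W p U ∂μ
    set e := ∫ U, W q U ∂(γ (Λs M) η)
    set e' := ∫ U, W q U ∂μ
    have hbe : |b| * |e - e'| + |e'| * |b - b'| ≤ |e - e'| + |b - b'| := by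
      have h1 : |b| * |e - e'| ≤ 1 * |e - e'| := mul_le_mul_of_nonneg_right (hWint p (γ (Λs M) η)) (abs_nonneg _)
      have h2 : |e'| * |b - b'| ≤ 1 * |b - b'| := mul_le_mul_of_nonneg_right (hWint q μ) (abs_nonneg _)
      linarith
    calc |a - b * e - (a' - b' * e')| = |(a - a') - (b * (e - e') + e' * (b - b'))| := by
          rw [show a - b * e - (a' - b' * e') = (a - a') - (b * (e - e') + e' * (b - b')) by ring]
      _ ≤ |a - a'| + |b * (e - e') + e' * (b - b')| := abs_sub _ _
      _ ≤ |a - a'| + (|b * (e - e')| + |e' * (b - b')|) := by gcongr; exact abs_add_le _ _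
      _ = |a - a'| + (|b| * |e - e'| + |e'| * |b - b'|) := by rw [abs_mul, abs_mul]
      _ ≤ |a - a'| + (|e - e'| + |b - b'|) := by linarith
      _ ≤ 2 * Real.sqrt 2 * 64 * 8 * ρk + (2 * Real.sqrt 2 * 32 * 4 * ρk + 2 * Real.sqrt 2 * 32 * 4 * ρk) := by
          gcongr
      _ = Bn := by rw [hBn, hρk]; ring
  have hfar : ∀ q : ZdPlaquette 4, q ∉ S (P + L) → |f q - cov[W p, W q; μ]| ≤ 2 * C * s ^ L * s ^ l1 (p.1 - q.1) := by
    intro q hq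
    -- `‖x_q‖_∞ > P + L`, so `‖x_p − x_q‖₁ ≥ ‖x_p − x_q‖_∞ ≥ L + 1`
    have hl1 : L ≤ l1 (p.1 - q.1) := by
      have hqn : ¬ q.1 ∈ box 4 (P + L) := fun h' => hq (Finset.mem_product.2 ⟨h', Finset.mem_univ _⟩)
      rw [mem_box] at hqn
      push Not at hqn
      obtain ⟨i, hi⟩ := hqn
      have hpi := (mem_box.1 hp) i
      have hcoord : (L : ℤ) ≤ |(p.1 - q.1) i| := by
        rw [Pi.sub_apply]
        rcases le_or_gt (-((P : ℤ) + L)) (q.1 i) with hle | hlt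
        · have := hi hle
          rw [abs_sub_comm, abs_of_nonneg (by omega)]
          push_cast at this ⊢; omega
        · rw [abs_of_nonneg (by omega)]
          omega
      have h1 : ((p.1 - q.1) i).natAbs ≤ l1 (p.1 - q.1) :=
        Finset.single_le_sum (f := fun j => ((p.1 - q.1) j).natAbs) (fun j _ => Nat.zero_le _) (Finset.mem_univ i)
      have h2 : (L : ℤ) ≤ ((p.1 - q.1) i).natAbs := by rw [Int.natCast_natAbs]; exact hcoord
      omega
    have hsl : s ^ l1 (p.1 - q.1) ≤ s ^ L := pow_le_pow_of_le_one hs0 hs1.le hl1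
    calc |f q - cov[W p, W q; μ]| ≤ |f q| + |cov[W p, W q; μ]| := abs_sub _ _
      _ ≤ C * r ^ l1 (p.1 - q.1) + C * r ^ l1 (p.1 - q.1) := add_le_add (hfb q) (hboundμ q)
      _ = 2 * C * (s ^ l1 (p.1 - q.1) * s ^ l1 (p.1 - q.1)) := by rw [hrs, mul_pow]; ring
      _ ≤ 2 * C * (s ^ L * s ^ l1 (p.1 - q.1)) :=
          mul_le_mul_of_nonneg_left (mul_le_mul_of_nonneg_right hsl (by positivity)) (by positivity)
      _ = 2 * C * s ^ L * s ^ l1 (p.1 - q.1) := by ring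
  -- the majorant and its sum
  set g : ZdPlaquette 4 → ℝ := fun q => (if q ∈ S (P + L) then Bn else 0) + 2 * C * s ^ L * s ^ l1 (p.1 - q.1) with hg
  have hmaj : ∀ q : ZdPlaquette 4, |f q - cov[W p, W q; μ]| ≤ g q := by
    intro q
    simp only [hg]
    by_cases hq : q ∈ S (P + L)
    · rw [if_pos hq]
      exact (hnear q hq).trans (le_add_of_nonneg_right (by positivity))
    · rw [if_neg hq, zero_add]
      exact hfar q hq
  have hrow2 := summable_and_tsum_row_le (d := 4) (c := 2 * C * s ^ L) (by positivity) hs0 hs1 p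
  have hind : Summable fun q : ZdPlaquette 4 => (if q ∈ S (P + L) then Bn else 0) :=
    summable_of_ne_finset_zero (s := S (P + L)) fun q hq => if_neg hq
  have hindsum : ∑' q : ZdPlaquette 4, (if q ∈ S (P + L) then Bn else 0) = (S (P + L)).card * Bn := by
    rw [tsum_eq_sum (s := S (P + L)) (fun q hq => if_neg hq), Finset.sum_ite_of_true (fun q hq => hq), Finset.sum_const,
      nsmul_eq_mul]
  have hcardS : ((S (P + L)).card : ℝ) = 6 * (2 * ((P + L : ℕ) : ℝ) + 1) ^ 4 := by
    rw [hS]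
    simp only [Finset.card_product, card_box, Finset.card_univ]
    rw [show Fintype.card {o : Fin 4 × Fin 4 // o.1 < o.2} = numOrient 4 from rfl, numOrient_four]
    push_cast
    ring
  have hgs : Summable g := hind.add hrow2.1
  have habs : Summable fun q : ZdPlaquette 4 => |f q - cov[W p, W q; μ]| := (hsumf.sub hsumμ).abs
  have htsum : |(∑' q, f q) - ∑' q, cov[W p, W q; μ]| ≤ ∑' q, g q := by
    rw [← hsumf.tsum_sub hsumμ]
    have h1 := norm_tsum_le_tsum_norm (f := fun q : ZdPlaquette 4 => f q - cov[W p, W q; μ])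
      (by simpa only [Real.norm_eq_abs] using habs)
    simp only [Real.norm_eq_abs] at h1
    exact h1.trans (habs.tsum_le_tsum hmaj hgs)
  have hsumg : ∑' q, g q ≤ (S (P + L)).card * Bn + 2 * C * s ^ L * (numOrient 4 * ((1 + s) / (1 - s)) ^ 4) := by
    show ∑' q : ZdPlaquette 4, ((if q ∈ S (P + L) then Bn else 0) + 2 * C * s ^ L * s ^ l1 (p.1 - q.1)) ≤ _
    rw [hind.tsum_add hrow2.1, hindsum]
    exact add_le_add le_rfl hrow2.2
  rw [← hfS]
  refine htsum.trans (hsumg.trans (le_of_eq ?_))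
  rw [hcardS, numOrient_four, hBn, hC, ht, hs]
  push_cast
  ring

end Summit.Ventures.YMGap.RobustBall

end
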